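import Literature.NumberTheory.EllipticCurves.TianYuanZhang2017.GenusPeriodsParity
import HarnessLib

/-!
# Sub-lane «bsd-p2»: the five decompositions of a product of three distinct primes (§5a of the series)

HONEST FRAMING (sub-lane «bsd-p2», run/shared/lean/b2b/bsd-rank1-residual/p2/, verbatim in every
file): the target of record is the FULL Birch–Swinnerton-Dyer formula for EVERY analytic-rank `≤ 1`
`E/ℚ` at ALL primes INCLUDING `2`; the odd-prime class ledger is referee A's; the `2`-part is OPEN
(cells O1 = X5 ∖ CM and O12 = the CM corner) and under census by «bsd-p2». Census / instrument
output at `2` = EVIDENCE / conjecture items with held-out validation, NEVER a Literature fact;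
certificates close PAIRS (one isogeny class, `p = 2`), never classes. This file asserts NO
arithmetic fact; pure combinatorics of Tian–Yuan–Zhang's "non-ordered decompositions
`n = d₀⋯d_ℓ`, `dᵢ > 1`" (`TianYuanZhang2017.decompositions`), PROVED: for distinct primes `a, b, c`,
`decompositions (abc) = {{abc}, {a, bc}, {b, ac}, {c, ab}, {a, b, c}}`, and a sum over them is the sum of five
terms (`sum_decompositions_three`) — the `k = 3` analogue of `decompositions_prime` (p325791), for
the genus sums of §5b. Part of the five-file series `CongruentClassSevenConfigurations` (§1: configurations + the finite
check) → `CongruentClassSevenConfigTransfer` (§2–§4: the prime tuple's data ARE functions of its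
Legendre configuration) → `DecompositionsThreePrimes` (§5a) → `GenusSumsThreePrimes` (§5b) →
`CongruentClassSevenKernelGenusParity` (§6: the `hgen`-free lemma for `ω(n) = 3` and the family door);
WAKE-theoremU of p2-lead ML-42 (W1′), source p2-idea-2 `O-rhoG-NOTE.md` v0.4 §8–§9, dictionary
countersigned in `p2/monsky/lit/A44-REDEI-GRAPH-COUNTERSIGN.md`. Unit `b2b-bsdres-p2-monsky-lit` GEN 7; NEW file.

References: [TianYuanZhang2017] Thm 1.1 / Thm 1.2 ("all decompositions … are non-ordered with
dᵢ > 1"); [HardyWright2008] §1.3 Thm 2.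
-/

open Finset Literature.NumberTheory.EllipticCurves.TianYuanZhang2017

set_option autoImplicit false

namespace Summit.BirchSwinnertonDyer.Rank1Residual.P2

section Decompositions

/-- Divisors of `abc` for primes `a, b, c`. [cite: HardyWright2008, §1.3 Thm. 2 (fundamental theorem of arithmetic)] -/
theorem dvd_mul_three_iff {a b c d : ℕ} (ha : a.Prime) (hb : b.Prime) (hc : c.Prime) :
    d ∣ a * b * c ↔ d = 1 ∨ d = a ∨ d = b ∨ d = c ∨ d = a * b ∨ d = a * c ∨ d = b * c ∨
      d = a * b * c := by
  constructor
  · intro h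
    obtain ⟨y, z, hy, hz, rfl⟩ := dvd_mul.mp h
    obtain ⟨y₁, y₂, hy₁, hy₂, rfl⟩ := dvd_mul.mp hy
    rcases (Nat.dvd_prime ha).mp hy₁ with rfl | rfl <;>
    rcases (Nat.dvd_prime hb).mp hy₂ with rfl | rfl <;>
    rcases (Nat.dvd_prime hc).mp hz with rfl | rfl <;> simp
  · rintro (rfl | rfl | rfl | rfl | rfl | rfl | rfl | rfl)
    · exact one_dvd _
    · exact Dvd.intro (b * c) (by ring)
    · exact Dvd.intro (a * c) (by ring)
    · exact Dvd.intro (a * b) (by ring)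
    · exact Dvd.intro c (by ring)
    · exact Dvd.intro b (by ring)
    · exact Dvd.intro a (by ring)
    · exact dvd_rfl

/-- A prime is not the product of a different prime with another factor. [cite: HardyWright2008, §1.3 Thm. 2] -/
theorem prime_ne_prime_mul {a b c : ℕ} (ha : a.Prime) (hb : b.Prime) (hab : a ≠ b) :
    a ≠ b * c := by
  intro h
  have hba : b ∣ a := ⟨c, h⟩
  have := (Nat.prime_dvd_prime_iff_eq hb ha).mp hba
  exact hab this.symm

/-- Finite sets are separated by an element of one that the other avoids (bookkeeping for the five decompositions). [cite: TianYuanZhang2017, Thm. 1.1 (decompositions)] -/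
theorem finset_ne_of_mem_of_not_mem {s t : Finset ℕ} {x : ℕ} (hs : x ∈ s) (ht : x ∉ t) : s ≠ t :=
  fun h => ht (h ▸ hs)

/-- The two-block case of the classification: if a decomposition of `u·v` (`v` prime, `v ∤ u`… here:
pairwise coprime factors `> 1` with product `u·v`) contains the block `u`, it is `{v, u}`.
[cite: TianYuanZhang2017, Thm. 1.1 ("non-ordered decompositions n = d₀⋯d_ℓ, dᵢ > 1")] -/
theorem eq_pair_of_mem {D : Finset ℕ} {u v : ℕ} (hv : v.Prime) (hu0 : 0 < u)
    (h1 : ∀ d ∈ D, 1 < d) (hcop : (D : Set ℕ).Pairwise Nat.Coprime)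
    (hdv : ∀ d ∈ D, d ∣ u * v) (hprod : ∏ d ∈ D, d = u * v) (hu : u ∈ D) : D = {v, u} := by
  -- every other block divides `v`, hence equals `v`
  have hother : ∀ d ∈ D, d ≠ u → d = v := by
    intro d hd hne
    have hcp : Nat.Coprime d u := hcop (Finset.mem_coe.mpr hd) (Finset.mem_coe.mpr hu) hne
    have hdv' : d ∣ v := hcp.dvd_of_dvd_mul_left (hdv d hd)
    rcases (Nat.dvd_prime hv).mp hdv' with h | h
    · exact absurd h (h1 d hd).ne'
    · exact h
  have hvD : v ∈ D := by
    by_contra hvD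
    have hDu : D = {u} := by
      refine Finset.eq_singleton_iff_unique_mem.mpr ⟨hu, fun d hd => ?_⟩
      by_contra hne
      exact hvD ((hother d hd hne) ▸ hd)
    rw [hDu, Finset.prod_singleton] at hprod
    have : v = 1 := by
      have h := hprod
      nth_rewrite 1 [← mul_one u] at h
      exact (Nat.eq_of_mul_eq_mul_left hu0 h).symm
    exact hv.one_lt.ne' this
  refine Finset.Subset.antisymm (fun d hd => ?_) ?_
  · rw [Finset.mem_insert, Finset.mem_singleton]
    by_cases hne : d = u
    · exact Or.inr hne
    · exact Or.inl (hother d hd hne)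
  · exact Finset.insert_subset_iff.mpr ⟨hvD, Finset.singleton_subset_iff.mpr hu⟩

variable {a b c : ℕ}

/-- **The decompositions of `n = abc` (three distinct primes) are the five set partitions**:
`{abc}`, `{a, bc}`, `{b, ac}`, `{c, ab}`, `{a, b, c}`.
[cite: TianYuanZhang2017, Thm. 1.1 ("all decompositions n = d₀⋯d_ℓ are non-ordered with dᵢ > 1")] -/
theorem mem_decompositions_three (ha : a.Prime) (hb : b.Prime) (hc : c.Prime) (hab : a ≠ b)
    (hac : a ≠ c) (hbc : b ≠ c) (D : Finset ℕ) :
    D ∈ decompositions (a * b * c) ↔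
      D = {a * b * c} ∨ D = {a, b * c} ∨ D = {b, a * c} ∨ D = {c, a * b} ∨ D = {a, b, c} := by
  have hn0 : a * b * c ≠ 0 := (Nat.mul_pos (Nat.mul_pos ha.pos hb.pos) hc.pos).ne'
  have hcab : Nat.Coprime a b := (Nat.coprime_primes ha hb).mpr hab
  have hcac : Nat.Coprime a c := (Nat.coprime_primes ha hc).mpr hac
  have hcbc : Nat.Coprime b c := (Nat.coprime_primes hb hc).mpr hbc
  have ha_bc : a ≠ b * c := prime_ne_prime_mul ha hb hab
  have hb_ac : b ≠ a * c := prime_ne_prime_mul hb ha hab.symm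
  have hc_ab : c ≠ a * b := prime_ne_prime_mul hc ha hac.symm
  constructor
  · intro hD
    simp only [decompositions, Finset.mem_filter, Finset.mem_powerset] at hD
    obtain ⟨hsub, h1, hcop, hprod⟩ := hD
    have hdv : ∀ d ∈ D, d ∣ a * b * c := fun d hd => Nat.dvd_of_mem_divisors (hsub hd)
    by_cases hn : a * b * c ∈ D
    · -- the one-block decomposition
      left
      refine Finset.eq_singleton_iff_unique_mem.mpr ⟨hn, fun d hd => ?_⟩
      by_contra hne
      have hcp : Nat.Coprime d (a * b * c) :=
        hcop (Finset.mem_coe.mpr hd) (Finset.mem_coe.mpr hn) hne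
      exact (h1 d hd).ne' (hcp.eq_one_of_dvd (hdv d hd))
    right
    by_cases h_ab : a * b ∈ D
    · right; right; left
      exact eq_pair_of_mem hc (Nat.mul_pos ha.pos hb.pos) h1 hcop hdv hprod h_ab
    by_cases h_ac : a * c ∈ D
    · right; left
      refine eq_pair_of_mem hb (Nat.mul_pos ha.pos hc.pos) h1 hcop (fun d hd => ?_) (hprod.trans (by ring)) h_ac
      exact (hdv d hd).trans ⟨1, by ring⟩
    by_cases h_bc : b * c ∈ D
    · left
      refine eq_pair_of_mem ha (Nat.mul_pos hb.pos hc.pos) h1 hcop (fun d hd => ?_) (hprod.trans (by ring)) h_bc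
      exact (hdv d hd).trans ⟨1, by ring⟩
    -- all blocks are primes
    right; right; right
    have hmem : ∀ d ∈ D, d = a ∨ d = b ∨ d = c := by
      intro d hd
      rcases (dvd_mul_three_iff ha hb hc).mp (hdv d hd) with h | h | h | h | h | h | h | h
      · exact absurd h (h1 d hd).ne'
      · exact Or.inl h
      · exact Or.inr (Or.inl h)
      · exact Or.inr (Or.inr h)
      · exact absurd hd (h ▸ h_ab)
      · exact absurd hd (h ▸ h_ac)
      · exact absurd hd (h ▸ h_bc)
      · exact absurd hd (h ▸ hn)
    -- each prime occurs
    have hocc : ∀ q, q.Prime → q ∣ a * b * c → (q = a ∨ q = b ∨ q = c) → q ∈ D := by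
      intro q hq hqd _
      rw [← hprod] at hqd
      obtain ⟨d, hd, hqd'⟩ := ((Nat.Prime.prime hq).dvd_finsetProd_iff _).mp hqd
      rcases hmem d hd with rfl | rfl | rfl
      · rwa [(Nat.prime_dvd_prime_iff_eq hq ha).mp hqd']
      · rwa [(Nat.prime_dvd_prime_iff_eq hq hb).mp hqd']
      · rwa [(Nat.prime_dvd_prime_iff_eq hq hc).mp hqd']
    have haD := hocc a ha (Dvd.intro (b * c) (by ring)) (Or.inl rfl)
    have hbD := hocc b hb (Dvd.intro (a * c) (by ring)) (Or.inr (Or.inl rfl))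
    have hcD := hocc c hc (Dvd.intro (a * b) (by ring)) (Or.inr (Or.inr rfl))
    refine Finset.Subset.antisymm (fun d hd => ?_) ?_
    · simpa only [Finset.mem_insert, Finset.mem_singleton] using hmem d hd
    · exact Finset.insert_subset_iff.mpr ⟨haD, Finset.insert_subset_iff.mpr
        ⟨hbD, Finset.singleton_subset_iff.mpr hcD⟩⟩
  · -- the five candidates are decompositions
    have mem_of : ∀ D : Finset ℕ, (∀ d ∈ D, d ∣ a * b * c) → (∀ d ∈ D, 1 < d) →
        (D : Set ℕ).Pairwise Nat.Coprime → ∏ d ∈ D, d = a * b * c →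
        D ∈ decompositions (a * b * c) := by
      intro D hdv h1 hcop hprod
      simp only [decompositions, Finset.mem_filter, Finset.mem_powerset]
      exact ⟨fun d hd => Nat.mem_divisors.mpr ⟨hdv d hd, hn0⟩, h1, hcop, hprod⟩
    have h1a := ha.one_lt
    have h1b := hb.one_lt
    have h1c := hc.one_lt
    have hn1 : 1 < a * b * c :=
      calc 1 < a := h1a
        _ ≤ a * b := Nat.le_mul_of_pos_right a hb.pos
        _ ≤ a * b * c := Nat.le_mul_of_pos_right _ hc.pos
    have hbc1 : 1 < b * c := lt_of_lt_of_le h1b (Nat.le_mul_of_pos_right b hc.pos)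
    have hac1 : 1 < a * c := lt_of_lt_of_le h1a (Nat.le_mul_of_pos_right a hc.pos)
    have hab1 : 1 < a * b := lt_of_lt_of_le h1a (Nat.le_mul_of_pos_right a hb.pos)
    rintro (rfl | rfl | rfl | rfl | rfl)
    · refine mem_of _ (by simp) (by simpa using hn1) (by simp) (by simp)
    · refine mem_of _ ?_ ?_ ?_ ?_
      · simp only [Finset.mem_insert, Finset.mem_singleton]
        rintro d (rfl | rfl)
        · exact Dvd.intro (b * c) (by ring)
        · exact Dvd.intro a (by ring)
      · simp only [Finset.mem_insert, Finset.mem_singleton]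
        rintro d (rfl | rfl)
        · exact h1a
        · exact hbc1
      · rw [Finset.coe_insert, Finset.coe_singleton, Set.pairwise_pair]
        exact fun _ => ⟨hcab.mul_right hcac, (hcab.mul_right hcac).symm⟩
      · rw [Finset.prod_insert (by simpa using ha_bc), Finset.prod_singleton]; ring
    · refine mem_of _ ?_ ?_ ?_ ?_
      · simp only [Finset.mem_insert, Finset.mem_singleton]
        rintro d (rfl | rfl)
        · exact Dvd.intro (a * c) (by ring)
        · exact Dvd.intro b (by ring)
      · simp only [Finset.mem_insert, Finset.mem_singleton]
        rintro d (rfl | rfl)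
        · exact h1b
        · exact hac1
      · rw [Finset.coe_insert, Finset.coe_singleton, Set.pairwise_pair]
        exact fun _ => ⟨hcab.symm.mul_right hcbc, (hcab.symm.mul_right hcbc).symm⟩
      · rw [Finset.prod_insert (by simpa using hb_ac), Finset.prod_singleton]; ring
    · refine mem_of _ ?_ ?_ ?_ ?_
      · simp only [Finset.mem_insert, Finset.mem_singleton]
        rintro d (rfl | rfl)
        · exact Dvd.intro (a * b) (by ring)
        · exact Dvd.intro c (by ring)
      · simp only [Finset.mem_insert, Finset.mem_singleton]
        rintro d (rfl | rfl)
        · exact h1c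
        · exact hab1
      · rw [Finset.coe_insert, Finset.coe_singleton, Set.pairwise_pair]
        exact fun _ => ⟨hcac.symm.mul_right hcbc.symm, (hcac.symm.mul_right hcbc.symm).symm⟩
      · rw [Finset.prod_insert (by simpa using hc_ab), Finset.prod_singleton]; ring
    · refine mem_of _ ?_ ?_ ?_ ?_
      · simp only [Finset.mem_insert, Finset.mem_singleton]
        rintro d (rfl | rfl | rfl)
        · exact Dvd.intro (b * c) (by ring)
        · exact Dvd.intro (a * c) (by ring)
        · exact Dvd.intro (a * b) (by ring)
      · simp only [Finset.mem_insert, Finset.mem_singleton]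
        rintro d (rfl | rfl | rfl)
        · exact h1a
        · exact h1b
        · exact h1c
      · rw [Finset.coe_insert, Finset.coe_insert, Finset.coe_singleton, Set.pairwise_insert,
          Set.pairwise_pair]
        refine ⟨fun _ => ⟨hcbc, hcbc.symm⟩, ?_⟩
        intro x hx _
        rcases hx with rfl | rfl
        · exact ⟨hcab, hcab.symm⟩
        · exact ⟨hcac, hcac.symm⟩
      · rw [Finset.prod_insert (by simp [hab, hac]), Finset.prod_insert (by simpa using hbc),
          Finset.prod_singleton]
        ring

/-- The same, as an equality of finite sets. [cite: TianYuanZhang2017, Thm. 1.1 (decompositions)] -/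
theorem decompositions_three (ha : a.Prime) (hb : b.Prime) (hc : c.Prime) (hab : a ≠ b)
    (hac : a ≠ c) (hbc : b ≠ c) :
    decompositions (a * b * c) = {{a * b * c}, {a, b * c}, {b, a * c}, {c, a * b}, {a, b, c}} := by
  ext D
  rw [mem_decompositions_three ha hb hc hab hac hbc]
  simp only [Finset.mem_insert, Finset.mem_singleton]

/-- **A sum over the decompositions of `abc` is the sum of five terms.**
[cite: TianYuanZhang2017, Thm. 1.1 (decompositions)] -/
theorem sum_decompositions_three {M : Type*} [AddCommMonoid M] (ha : a.Prime) (hb : b.Prime)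
    (hc : c.Prime) (hab : a ≠ b) (hac : a ≠ c) (hbc : b ≠ c) (F : Finset ℕ → M) :
    ∑ D ∈ decompositions (a * b * c), F D =
      F {a * b * c} + (F {a, b * c} + (F {b, a * c} + (F {c, a * b} + F {a, b, c}))) := by
  have ha2 := ha.two_le
  have hb2 := hb.two_le
  have hc2 := hc.two_le
  -- membership pattern of `a`, `b`, `c` in the five sets separates them
  have hab' : a < a * b := (Nat.lt_mul_iff_one_lt_right ha.pos).mpr hb.one_lt
  have habc : a * b < a * b * c := (Nat.lt_mul_iff_one_lt_right (Nat.mul_pos ha.pos hb.pos)).mpr hc.one_lt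
  have hb' : b < a * b := (Nat.lt_mul_iff_one_lt_left hb.pos).mpr ha.one_lt
  have hc' : c < a * b * c :=
    (Nat.lt_mul_iff_one_lt_left hc.pos).mpr (lt_of_lt_of_le ha.one_lt (Nat.le_mul_of_pos_right a hb.pos))
  have ha1 : a ∉ ({a * b * c} : Finset ℕ) := by
    rw [Finset.mem_singleton]; exact (hab'.trans habc).ne
  have hb1 : b ∉ ({a * b * c} : Finset ℕ) := by
    rw [Finset.mem_singleton]; exact (hb'.trans habc).ne
  have hc1 : c ∉ ({a * b * c} : Finset ℕ) := by
    rw [Finset.mem_singleton]; exact hc'.ne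
  have ha3 : a ∉ ({b, a * c} : Finset ℕ) := by
    simp only [Finset.mem_insert, Finset.mem_singleton, not_or]; exact ⟨hab, by nlinarith⟩
  have ha4 : a ∉ ({c, a * b} : Finset ℕ) := by
    simp only [Finset.mem_insert, Finset.mem_singleton, not_or]; exact ⟨hac, by nlinarith⟩
  have hb2' : b ∉ ({a, b * c} : Finset ℕ) := by
    simp only [Finset.mem_insert, Finset.mem_singleton, not_or]; exact ⟨hab.symm, by nlinarith⟩
  have hb4 : b ∉ ({c, a * b} : Finset ℕ) := by
    simp only [Finset.mem_insert, Finset.mem_singleton, not_or]; exact ⟨hbc, by nlinarith⟩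
  have ha2' : a ∈ ({a, b * c} : Finset ℕ) := by simp
  have hb3 : b ∈ ({b, a * c} : Finset ℕ) := by simp
  have hc4 : c ∈ ({c, a * b} : Finset ℕ) := by simp
  have ha5 : a ∈ ({a, b, c} : Finset ℕ) := by simp
  have hb5 : b ∈ ({a, b, c} : Finset ℕ) := by simp
  have n1 : ({a * b * c} : Finset ℕ) ∉
      ({{a, b * c}, {b, a * c}, {c, a * b}, {a, b, c}} : Finset (Finset ℕ)) := by
    simp only [Finset.mem_insert, Finset.mem_singleton, not_or]
    exact ⟨(finset_ne_of_mem_of_not_mem ha2' ha1).symm, (finset_ne_of_mem_of_not_mem hb3 hb1).symm,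
      (finset_ne_of_mem_of_not_mem hc4 hc1).symm, (finset_ne_of_mem_of_not_mem ha5 ha1).symm⟩
  have n2 : ({a, b * c} : Finset ℕ) ∉ ({{b, a * c}, {c, a * b}, {a, b, c}} : Finset (Finset ℕ)) := by
    simp only [Finset.mem_insert, Finset.mem_singleton, not_or]
    exact ⟨finset_ne_of_mem_of_not_mem ha2' ha3, finset_ne_of_mem_of_not_mem ha2' ha4,
      (finset_ne_of_mem_of_not_mem hb5 hb2').symm⟩
  have n3 : ({b, a * c} : Finset ℕ) ∉ ({{c, a * b}, {a, b, c}} : Finset (Finset ℕ)) := by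
    simp only [Finset.mem_insert, Finset.mem_singleton, not_or]
    exact ⟨finset_ne_of_mem_of_not_mem hb3 hb4, (finset_ne_of_mem_of_not_mem ha5 ha3).symm⟩
  have n4 : ({c, a * b} : Finset ℕ) ≠ {a, b, c} := (finset_ne_of_mem_of_not_mem ha5 ha4).symm
  rw [decompositions_three ha hb hc hab hac hbc, Finset.sum_insert n1, Finset.sum_insert n2,
    Finset.sum_insert n3, Finset.sum_pair n4]

end Decompositions

end Summit.BirchSwinnertonDyer.Rank1Residual.P2
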